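import Summits.Ventures.PercRepro.ThetaOmegaGraphThree

/-!
# The graph form of (Ω): monotonicity in the family, and what the three-member theorem gives

The graph count is monotone in the family (`omegaCountG_mono`: the counted sets of a subfamily
are counted sets of the family, for the same graph and ground set) and the triple condition
restricts to subfamilies (`slotTripleRel_mono`). Two consequences:

* `three_le_omegaCountG_of_three_le_card` — every family of at least three members, with any
  symmetric graph of independence number ≤ 2 on its slots, has at least three edge-meets (choose
  three members and apply `three_le_omegaCountG`);
* `card_le_omegaCountG_of_erase` — **the deletion step**: if every subfamily with one member fewer
  already has at least `|F|` edge-meets (the bound with slack one at size `|F| - 1`), so has `F`.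
  With the SAT certificates of Addendum 84 («no tight instance at `|F| = k` on any ground set»)
  this is the step that carries the graph form from size `k` to size `k + 1`.
-/

namespace PercRepro.MSTight

open Finset

variable {α : Type*} [DecidableEq α]

section Mono

variable {Γ : Slot α → Slot α → Prop} [DecidableRel Γ] {U : Finset α} {F F' : Finset (Finset α)}

/-- The relation `A`-family is monotone in the family. -/
theorem omegaAR_mono {L : Type*} {R : L → L → Prop} [DecidableRel R] {l0 l1 : Finset α → L}
    (h : F' ⊆ F) : omegaAR R F' l0 l1 ⊆ omegaAR R F l0 l1 := by
  intro E hE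
  rcases mem_omegaAR.1 hE with ⟨s, hs, t, ht, hst, hr, rfl⟩ | ⟨s, hs, t, ht, hr, rfl⟩
  · exact mem_omegaAR.2 (Or.inl ⟨s, h hs, t, h ht, hst, hr, rfl⟩)
  · exact mem_omegaAR.2 (Or.inr ⟨s, h hs, t, h ht, hr, rfl⟩)

/-- The relation `C`-family is monotone in the family. -/
theorem omegaCR_mono {L : Type*} {R : L → L → Prop} [DecidableRel R] {l1 : Finset α → L}
    (h : F' ⊆ F) : omegaCR R U F' l1 ⊆ omegaCR R U F l1 := by
  intro E hE
  obtain ⟨s, hs, t, ht, hst, hr, rfl⟩ := mem_omegaCR.1 hE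
  exact mem_omegaCR.2 ⟨s, h hs, t, h ht, hst, hr, rfl⟩

/-- The relation count is monotone in the family. -/
theorem omegaCountR_mono {L : Type*} {R : L → L → Prop} [DecidableRel R]
    {l0 l1 : Finset α → L} (h : F' ⊆ F) :
    omegaCountR R U F' l0 l1 ≤ omegaCountR R U F l0 l1 :=
  Nat.add_le_add (card_le_card (omegaAR_mono h)) (card_le_card (omegaCR_mono h))

/-- The graph count is monotone in the family. -/
theorem omegaCountG_mono (h : F' ⊆ F) : omegaCountG Γ U F' ≤ omegaCountG Γ U F :=
  omegaCountR_mono h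

omit [DecidableEq α] [DecidableRel Γ] in
/-- The triple condition restricts to subfamilies. -/
theorem slotTripleRel_mono (hT : SlotTripleRel Γ F) (h : F' ⊆ F) : SlotTripleRel Γ F' :=
  fun u v w hu hv hw => hT u v w (h hu) (h hv) (h hw)

/-- **At least three edge-meets for any family of at least three members** (with any symmetric
graph of independence number ≤ 2 on its slots). -/
theorem three_le_omegaCountG_of_three_le_card (hsym : ∀ u v, Γ u v → Γ v u)
    (hF : ∀ x ∈ F, x ⊆ U) (h3 : 3 ≤ F.card) (hT : SlotTripleRel Γ F) :
    3 ≤ omegaCountG Γ U F := by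
  obtain ⟨F', hF'F, hF'3⟩ := exists_subset_card_eq h3
  exact le_trans (three_le_omegaCountG hsym (fun x hx => hF x (hF'F hx)) hF'3
    (slotTripleRel_mono hT hF'F)) (omegaCountG_mono hF'F)

/-- **The deletion step**: if every subfamily of `F` with one member fewer has at least `|F|`
edge-meets, so has `F`. -/
theorem card_le_omegaCountG_of_erase (hne : F.Nonempty)
    (h : ∀ s ∈ F, F.card ≤ omegaCountG Γ U (F.erase s)) : F.card ≤ omegaCountG Γ U F := by
  obtain ⟨s, hs⟩ := hne
  exact le_trans (h s hs) (omegaCountG_mono (erase_subset s F))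

end Mono

end PercRepro.MSTight
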